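import Mathlib
import Literature.Analysis.FluidPDE.NSFourierAPriori
import Summits.NavierStokesRegularity.NavierStokesRegularity.Theses.FrozenSignCascade
import Summits.NavierStokesRegularity.NavierStokesRegularity.Theorems.FrozenSignCascadeEnvelopeBoundStubAgmonL1
import HarnessLib

/-!
# Route FrozenSignCascade · crux `EnvelopeBound` (stmt-NavierStokesRegularity-1549), line
  `registered` (reshape r3): stub `stub_productionL2` — the enstrophy production against the
  `L²` bound of the nonlinearity

Support file for the crux item stmt-NavierStokesRegularity-1549 (`EnvelopeBound`, route
`FrozenSignCascade`, line `registered`, lead c3); lands `--supports` that item. It proves the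
registered stub `stub_productionL2` of the line's skeleton: there is an absolute `K₁ ≥ 0` such that
for every continuous coefficient field `v : ℝ³ → ℂ³` on frequency space with decay of every order,

  `|∫ ‖ξ‖² ∑ₗ Re(conj(vₗ) N(v,v)ₗ) dξ| ≤ K₁ · D^{1/2} · M · Ens^{1/2}`,

`Ens = ∫ ‖ξ‖² ∑ₗ ‖vₗ‖²`, `D = ∫ ‖ξ‖⁴ ∑ₗ ‖vₗ‖²`, `M = ∫ ‖v(ξ)‖ dξ` — the Fourier form of Leray's
production estimate `|∫ (u·∇u)·Δu| ≤ ‖Δu‖₂ ‖û‖₁ ‖∇u‖₂`. Mechanism: the pointwise bound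
`|‖ξ‖² ∑ₗ Re(conj(vₗ) Nₗ)| ≤ (‖ξ‖² ∑ₗ ‖vₗ‖) ‖N‖`, Cauchy–Schwarz in `ξ`
(`sq_integral_mul_le_of_integrable`) with `(∑ₗ ‖vₗ‖)² ≤ 3 ∑ₗ ‖vₗ‖²`, and the tree's `L²` bound of
the nonlinearity under a bound of the synthesis, `‖N(v,v)‖_{L²} ≤ C_ι M ‖ ‖ξ‖ v ‖_{L²}`
(`eLpNorm_nonlin_le`) with `M = ‖v‖_{L¹_ξ} ≥ sup |𝓕 vₗ|`; `K₁ = √3 · C_{Fin 3}`. The `ℂ³`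
bookkeeping (`pi_norm_sq_le_sum_norm_sq`, `sum_norm_sq_le_three_mul`,
`integrable_pow_mul_sum_norm_sq`) is reused from the landed neighbour `…EnvelopeBoundStubAgmonL1`.

References: J. Leray, Acta Math. 63 (1934) §20; P. G. Lemarié-Rieusset, *The Navier–Stokes
problem in the 21st century* (2016), Thm. 7.2, §8.5.
-/

noncomputable section

set_option linter.dupNamespace false -- nested layout Summit.<S>.<Sub>, Sub = S (D-0017)

open Set MeasureTheory Filter Topology Real
open scoped ComplexConjugate InnerProductSpace FourierTransform ENNReal
open Literature.Analysis.FluidPDE Literature.Analysis.FluidPDE.FourierNS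

namespace Summit.NavierStokesRegularity.NavierStokesRegularity.Theorems.EnvelopeBound.Leray

/-! ### Elementary inequalities on `ℂ³` -/

/-- Cauchy–Schwarz on `Fin 3`: `(∑ₗ ‖zₗ‖)² ≤ 3 ∑ₗ ‖zₗ‖²`. -/
theorem sq_sum_norm_le_three_mul_sum_sq (z : Fin 3 → ℂ) :
    (∑ l, ‖z l‖) ^ 2 ≤ 3 * ∑ l, ‖z l‖ ^ 2 := by
  simp only [Fin.sum_univ_three]
  nlinarith [sq_nonneg (‖z 0‖ - ‖z 1‖), sq_nonneg (‖z 1‖ - ‖z 2‖), sq_nonneg (‖z 0‖ - ‖z 2‖)]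

/-- `∑ₗ ‖zₗ‖ ≤ 3 ‖z‖` on `ℂ³` (each component is bounded by the sup norm). -/
theorem sum_norm_le_three_mul_norm (z : Fin 3 → ℂ) : ∑ l, ‖z l‖ ≤ 3 * ‖z‖ := by
  calc ∑ l, ‖z l‖ ≤ ∑ _l : Fin 3, ‖z‖ := Finset.sum_le_sum fun l _ => norm_le_pi_norm z l
    _ = 3 * ‖z‖ := by simp

/-- The pointwise bound of the production density:
`|‖ξ‖² ∑ₗ Re(conj(vₗ) N(v,v)ₗ)| ≤ (‖ξ‖² ∑ₗ ‖vₗ‖) ‖N(v,v)‖`. -/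
theorem abs_productionDensity_le (v : EuclideanSpace ℝ (Fin 3) → Fin 3 → ℂ)
    (ξ : EuclideanSpace ℝ (Fin 3)) :
    |‖ξ‖ ^ 2 * ∑ l, (conj (v ξ l) * nonlin v v ξ l).re| ≤
      (‖ξ‖ ^ 2 * ∑ l, ‖v ξ l‖) * ‖nonlin v v ξ‖ := by
  rw [abs_mul, abs_of_nonneg (by positivity : (0 : ℝ) ≤ ‖ξ‖ ^ 2), mul_assoc, Finset.sum_mul]
  refine mul_le_mul_of_nonneg_left ?_ (by positivity)
  refine (Finset.abs_sum_le_sum_abs _ _).trans (Finset.sum_le_sum fun l _ => ?_)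
  calc |(conj (v ξ l) * nonlin v v ξ l).re| ≤ ‖conj (v ξ l) * nonlin v v ξ l‖ :=
        Complex.abs_re_le_norm _
    _ = ‖v ξ l‖ * ‖nonlin v v ξ l‖ := by rw [norm_mul, Complex.norm_conj]
    _ ≤ ‖v ξ l‖ * ‖nonlin v v ξ‖ :=
        mul_le_mul_of_nonneg_left (norm_le_pi_norm _ l) (norm_nonneg _)

/-! ### The stub -/

/-- **Stub `stub_productionL2` — the enstrophy production against the `L²` bound of the
nonlinearity.** There is an absolute `K₁ ≥ 0` such that for every continuous coefficient field
`v : ℝ³ → ℂ³` with decay of every order,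
`|∫ ‖ξ‖² ∑ₗ Re(conj(vₗ) N(v,v)ₗ)| ≤ K₁ · D^{1/2} · (∫‖v‖) · Ens^{1/2}`,
`Ens = ∫‖ξ‖²∑ₗ‖vₗ‖²`, `D = ∫‖ξ‖⁴∑ₗ‖vₗ‖²` (Leray 1934, §20: `|∫(u·∇u)·Δu| ≤ ‖Δu‖₂ ‖û‖₁ ‖∇u‖₂`
on the Fourier side). Proof: Cauchy–Schwarz in `ξ` after the pointwise bound
`abs_productionDensity_le` and `(∑ₗ‖vₗ‖)² ≤ 3∑ₗ‖vₗ‖²`, then `eLpNorm_nonlin_le` with the synthesis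
bound `|𝓕 vₗ| ≤ ∫‖v‖` and `‖v ξ‖² ≤ ∑ₗ ‖v ξ l‖²`; `K₁ = √3 · nonlinL2Const (Fin 3)`. -/
theorem stub_productionL2 :
    ∃ K₁ : ℝ, 0 ≤ K₁ ∧ ∀ (v : EuclideanSpace ℝ (Fin 3) → Fin 3 → ℂ), Continuous v →
      (∀ K : ℕ, ∃ A : ℝ, Literature.Analysis.FluidPDE.FourierNS.HasDecay K A v) →
      |∫ ξ, ‖ξ‖ ^ 2 * ∑ l, ((starRingEnd ℂ) (v ξ l) *
          Literature.Analysis.FluidPDE.FourierNS.nonlin v v ξ l).re| ≤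
        K₁ * (∫ ξ, ‖ξ‖ ^ 4 * ∑ l, ‖v ξ l‖ ^ 2) ^ (1 / 2 : ℝ) * (∫ ξ, ‖v ξ‖) *
          (∫ ξ, ‖ξ‖ ^ 2 * ∑ l, ‖v ξ l‖ ^ 2) ^ (1 / 2 : ℝ) := by
  have hC0 : 0 ≤ nonlinL2Const (Fin 3) := nonlinL2Const_nonneg
  refine ⟨Real.sqrt 3 * nonlinL2Const (Fin 3), mul_nonneg (Real.sqrt_nonneg _) hC0, ?_⟩
  intro v hvc hdec
  -- the three functionals
  set D : ℝ := ∫ ξ, ‖ξ‖ ^ 4 * ∑ l, ‖v ξ l‖ ^ 2 with hD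
  set Ens : ℝ := ∫ ξ, ‖ξ‖ ^ 2 * ∑ l, ‖v ξ l‖ ^ 2 with hEns
  set M : ℝ := ∫ ξ, ‖v ξ‖ with hM
  have hD0 : 0 ≤ D := integral_nonneg fun ξ => by positivity
  have hEns0 : 0 ≤ Ens := integral_nonneg fun ξ => by positivity
  have hM0 : 0 ≤ M := integral_nonneg fun ξ => norm_nonneg _
  -- decay and measurability
  have hK₀ : Fintype.card (Fin 3) < 4 := by simp
  have hvm : AEStronglyMeasurable v volume := hvc.aestronglyMeasurable
  obtain ⟨A, hA⟩ := hdec 6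
  have hA0 : 0 ≤ A := hA.nonneg
  have hA4 : HasDecay 4 A v := hA.of_le (by norm_num)
  have hA5 : HasDecay (1 + 4) A v := hA.of_le (by norm_num)
  have hA5' : HasDecay (4 + 1) A v := hA.of_le (by norm_num)
  have hA6 : HasDecay (2 + 4) A v := hA.of_le (by norm_num)
  have hvi : Integrable v := hA4.integrable (finrank_lt_of_card_lt hK₀) hvm
  -- the nonlinearity: continuous, with decay of the integrable order
  have hNc : Continuous fun ξ => nonlin v v ξ :=
    continuous_nonlin_param (X := EuclideanSpace ℝ (Fin 3)) hK₀ (V := fun _ => v) (W := fun _ => v)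
      (ζ := id) (fun _ => hvm) (fun _ => hvm) (fun _ => hA4) (fun _ => hA4)
      (fun _ => continuous_const) (fun _ => hvc.comp (continuous_id.sub continuous_const))
      continuous_id
  have hNm : AEStronglyMeasurable (nonlin v v) volume := hNc.aestronglyMeasurable
  have hNd : HasDecay 4 (nonlinConst (Fin 3) (4 + 1) 4 * (A * A + A * A)) (nonlin v v) :=
    hasDecay_nonlin hK₀ hA4 hA5' hA4 hA5' hvm hvm
  set B : ℝ := nonlinConst (Fin 3) (4 + 1) 4 * (A * A + A * A) with hB
  have hB0 : 0 ≤ B := hNd.nonneg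
  have hNb : ∀ ξ, ‖nonlin v v ξ‖ ≤ B := fun ξ => hNd.norm_le ξ
  -- the two Cauchy–Schwarz factors
  set f : EuclideanSpace ℝ (Fin 3) → ℝ := fun ξ => ‖ξ‖ ^ 2 * ∑ l, ‖v ξ l‖ with hf
  set g : EuclideanSpace ℝ (Fin 3) → ℝ := fun ξ => ‖nonlin v v ξ‖ with hg
  have hf0 : ∀ ξ, 0 ≤ f ξ := fun ξ => by
    simp only [hf]; exact mul_nonneg (by positivity) (Finset.sum_nonneg fun l _ => norm_nonneg _)
  have hfm : AEStronglyMeasurable f volume :=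
    ((continuous_norm.pow 2).mul (continuous_finsetSum _ fun l _ =>
      ((continuous_apply l).comp hvc).norm)).aestronglyMeasurable
  have hgm : AEStronglyMeasurable g volume := hNc.norm.aestronglyMeasurable
  -- integrability: `‖ξ‖² ‖v‖`, `‖ξ‖⁴ ‖v‖²`
  have hI2 : Integrable fun ξ : EuclideanSpace ℝ (Fin 3) => ‖ξ‖ ^ 2 * ‖v ξ‖ :=
    hA6.integrable_pow_mul_norm (finrank_lt_of_card_lt hK₀) hvm
  have hI4 : Integrable fun ξ : EuclideanSpace ℝ (Fin 3) => ‖ξ‖ ^ 4 * ‖v ξ‖ ^ 2 :=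
    integrable_norm_pow_four_mul_norm_sq_of_hasDecay hK₀ hA6 hvm
  have hf_le : ∀ ξ, f ξ ≤ 3 * (‖ξ‖ ^ 2 * ‖v ξ‖) := fun ξ => by
    simp only [hf]
    calc ‖ξ‖ ^ 2 * ∑ l, ‖v ξ l‖ ≤ ‖ξ‖ ^ 2 * (3 * ‖v ξ‖) :=
          mul_le_mul_of_nonneg_left (sum_norm_le_three_mul_norm (v ξ)) (by positivity)
      _ = 3 * (‖ξ‖ ^ 2 * ‖v ξ‖) := by ring
  have hf2 : Integrable (fun ξ => f ξ ^ 2) volume := by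
    refine (hI4.const_mul 9).mono' (hfm.pow 2) (Eventually.of_forall fun ξ => ?_)
    rw [Real.norm_of_nonneg (sq_nonneg _)]
    calc f ξ ^ 2 ≤ (3 * (‖ξ‖ ^ 2 * ‖v ξ‖)) ^ 2 := pow_le_pow_left₀ (hf0 ξ) (hf_le ξ) 2
      _ = 9 * (‖ξ‖ ^ 4 * ‖v ξ‖ ^ 2) := by ring
  have hg2 : Integrable (fun ξ => g ξ ^ 2) volume := integrable_norm_sq_of_hasDecay hK₀ hNd hNm
  have hfg : Integrable (fun ξ => f ξ * g ξ) volume := by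
    refine (hI2.const_mul (3 * B)).mono' (hfm.mul hgm) (Eventually.of_forall fun ξ => ?_)
    rw [Real.norm_of_nonneg (mul_nonneg (hf0 ξ) (norm_nonneg _))]
    calc f ξ * g ξ ≤ 3 * (‖ξ‖ ^ 2 * ‖v ξ‖) * B :=
          mul_le_mul (hf_le ξ) (hNb ξ) (norm_nonneg _) (by positivity)
      _ = 3 * B * (‖ξ‖ ^ 2 * ‖v ξ‖) := by ring
  -- `∫ f² ≤ 3 D`
  have hDi : Integrable (fun ξ : EuclideanSpace ℝ (Fin 3) => ‖ξ‖ ^ 4 * ∑ l, ‖v ξ l‖ ^ 2) volume :=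
    integrable_pow_mul_sum_norm_sq hvc hI4
  have hf2_le : ∫ ξ, f ξ ^ 2 ≤ 3 * D := by
    rw [hD, ← integral_const_mul]
    refine integral_mono_of_nonneg (Eventually.of_forall fun ξ => sq_nonneg _) (hDi.const_mul 3)
      (Eventually.of_forall fun ξ => ?_)
    show f ξ ^ 2 ≤ 3 * (‖ξ‖ ^ 4 * ∑ l, ‖v ξ l‖ ^ 2)
    simp only [hf]
    calc (‖ξ‖ ^ 2 * ∑ l, ‖v ξ l‖) ^ 2 = ‖ξ‖ ^ 4 * (∑ l, ‖v ξ l‖) ^ 2 := by ring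
      _ ≤ ‖ξ‖ ^ 4 * (3 * ∑ l, ‖v ξ l‖ ^ 2) :=
          mul_le_mul_of_nonneg_left (sq_sum_norm_le_three_mul_sum_sq (v ξ)) (by positivity)
      _ = 3 * (‖ξ‖ ^ 4 * ∑ l, ‖v ξ l‖ ^ 2) := by ring
  -- `∫ g² ≤ (C M)² Ens`: the `L²` bound of the nonlinearity
  have hMb : ∀ x l, ‖𝓕 (fun ξ => v ξ l) x‖ ≤ M := by
    intro x l
    calc ‖𝓕 (fun ξ => v ξ l) x‖ ≤ ∫ ξ, ‖v ξ l‖ :=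
          VectorFourier.norm_fourierIntegral_le_integral_norm _ _ _ _ _
      _ ≤ M := integral_mono_of_nonneg (Eventually.of_forall fun ξ => norm_nonneg _) hvi.norm
          (Eventually.of_forall fun ξ => norm_le_pi_norm (v ξ) l)
  have hL2 : eLpNorm (nonlin v v) 2 volume ≤ ENNReal.ofReal (nonlinL2Const (Fin 3) * M) *
      eLpNorm (fun ξ => ‖ξ‖ * ‖v ξ‖) 2 volume :=
    eLpNorm_nonlin_le hK₀ hvc hA5 hMb
  have hw2 : Integrable (fun ξ : EuclideanSpace ℝ (Fin 3) => ‖ξ‖ ^ 2 * ‖v ξ‖ ^ 2) volume := by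
    refine (hI2.const_mul A).mono' ((continuous_norm.pow 2).mul (hvc.norm.pow 2)).aestronglyMeasurable
      (Eventually.of_forall fun ξ => ?_)
    rw [Real.norm_of_nonneg (by positivity)]
    calc ‖ξ‖ ^ 2 * ‖v ξ‖ ^ 2 = ‖v ξ‖ * (‖ξ‖ ^ 2 * ‖v ξ‖) := by ring
      _ ≤ A * (‖ξ‖ ^ 2 * ‖v ξ‖) := mul_le_mul_of_nonneg_right (hA4.norm_le ξ) (by positivity)
  have hsqN : eLpNorm (nonlin v v) 2 volume ^ 2 = ENNReal.ofReal (∫ ξ, g ξ ^ 2) := by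
    rw [eLpNorm_two_sq, ofReal_integral_eq_lintegral_ofReal hg2
      (Eventually.of_forall fun ξ => sq_nonneg _)]
    refine lintegral_congr fun ξ => ?_
    rw [hg, ← ofReal_norm, ENNReal.ofReal_pow (norm_nonneg _)]
  have hsqW : eLpNorm (fun ξ : EuclideanSpace ℝ (Fin 3) => ‖ξ‖ * ‖v ξ‖) 2 volume ^ 2 =
      ENNReal.ofReal (∫ ξ, ‖ξ‖ ^ 2 * ‖v ξ‖ ^ 2) := by
    rw [eLpNorm_two_sq, ofReal_integral_eq_lintegral_ofReal hw2
      (Eventually.of_forall fun ξ => by positivity)]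
    refine lintegral_congr fun ξ => ?_
    rw [enorm_sq_eq_ofReal_sq, mul_pow]
  have hCM0 : 0 ≤ nonlinL2Const (Fin 3) * M := mul_nonneg hC0 hM0
  have hg2_le' : ∫ ξ, g ξ ^ 2 ≤ (nonlinL2Const (Fin 3) * M) ^ 2 * ∫ ξ, ‖ξ‖ ^ 2 * ‖v ξ‖ ^ 2 := by
    have h1 := pow_le_pow_left' hL2 2
    rw [mul_pow, hsqN, hsqW, ← ENNReal.ofReal_pow hCM0,
      ← ENNReal.ofReal_mul (sq_nonneg _)] at h1
    exact (ENNReal.ofReal_le_ofReal_iff (mul_nonneg (sq_nonneg _)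
      (integral_nonneg fun ξ => by positivity))).1 h1
  have hEnsi : Integrable (fun ξ : EuclideanSpace ℝ (Fin 3) => ‖ξ‖ ^ 2 * ∑ l, ‖v ξ l‖ ^ 2) volume :=
    integrable_pow_mul_sum_norm_sq hvc hw2
  have hwEns : ∫ ξ, ‖ξ‖ ^ 2 * ‖v ξ‖ ^ 2 ≤ Ens :=
    integral_mono_of_nonneg (Eventually.of_forall fun ξ => by positivity) hEnsi
      (Eventually.of_forall fun ξ =>
        mul_le_mul_of_nonneg_left (pi_norm_sq_le_sum_norm_sq (v ξ)) (by positivity))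
  have hg2_le : ∫ ξ, g ξ ^ 2 ≤ (nonlinL2Const (Fin 3) * M) ^ 2 * Ens :=
    hg2_le'.trans (mul_le_mul_of_nonneg_left hwEns (sq_nonneg _))
  -- Cauchy–Schwarz in `ξ`
  have hCS : (∫ ξ, f ξ * g ξ) ^ 2 ≤ (∫ ξ, f ξ ^ 2) * ∫ ξ, g ξ ^ 2 :=
    sq_integral_mul_le_of_integrable hf2 hg2 hfg
  have hPJ : |∫ ξ, ‖ξ‖ ^ 2 * ∑ l, (conj (v ξ l) * nonlin v v ξ l).re| ≤ ∫ ξ, f ξ * g ξ := by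
    rw [← Real.norm_eq_abs]
    refine norm_integral_le_of_norm_le hfg (Eventually.of_forall fun ξ => ?_)
    rw [Real.norm_eq_abs]
    exact abs_productionDensity_le v ξ
  -- assemble
  rw [← Real.sqrt_eq_rpow D, ← Real.sqrt_eq_rpow Ens]
  refine abs_le_of_sq_le_sq ?_ (mul_nonneg (mul_nonneg (mul_nonneg (mul_nonneg
    (Real.sqrt_nonneg _) hC0) (Real.sqrt_nonneg _)) hM0) (Real.sqrt_nonneg _))
  have hT : (Real.sqrt 3 * nonlinL2Const (Fin 3) * Real.sqrt D * M * Real.sqrt Ens) ^ 2 =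
      3 * nonlinL2Const (Fin 3) ^ 2 * D * M ^ 2 * Ens := by
    rw [mul_pow, mul_pow, mul_pow, mul_pow, Real.sq_sqrt (by norm_num : (0 : ℝ) ≤ 3),
      Real.sq_sqrt hD0, Real.sq_sqrt hEns0]
  rw [hT]
  calc (∫ ξ, ‖ξ‖ ^ 2 * ∑ l, (conj (v ξ l) * nonlin v v ξ l).re) ^ 2
      = |∫ ξ, ‖ξ‖ ^ 2 * ∑ l, (conj (v ξ l) * nonlin v v ξ l).re| ^ 2 := (sq_abs _).symm
    _ ≤ (∫ ξ, f ξ * g ξ) ^ 2 := pow_le_pow_left₀ (abs_nonneg _) hPJ 2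
    _ ≤ (∫ ξ, f ξ ^ 2) * ∫ ξ, g ξ ^ 2 := hCS
    _ ≤ (3 * D) * ((nonlinL2Const (Fin 3) * M) ^ 2 * Ens) :=
        mul_le_mul hf2_le hg2_le (integral_nonneg fun ξ => sq_nonneg _) (by positivity)
    _ = 3 * nonlinL2Const (Fin 3) ^ 2 * D * M ^ 2 * Ens := by ring

end Summit.NavierStokesRegularity.NavierStokesRegularity.Theorems.EnvelopeBound.Leray

end
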